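import Summits.CriticalPhenomena.PercolationContinuityZ3.Theorems.Transplant.SkelPhiQStepSelection
import Literature.Barriers.CriticalPhenomena.SubexponentialGrowthZdProofs
import HarnessLib

/-!
# Quasi-step SELECTION, II: the chart application — fibre graph, ports, step data with finite fibre closures, FINITE HULLS

builds on p205010 (kernel theorem, internal audit signed; external expert review pending) — nothing in this file uses p205010 and nothing here is a
percolation statement or a claim about any node.  Lane `prim-bschramm`, seat `prim-bschramm-p5` gen 30 (refuter / sharpness seat; memo
HOME/prim-bschramm-p5-g30/Q3-R1.md; lead g24 GO 2026-08-27 18:51Z: helper rows, no rung).  Helper file (`--supports stmt-CriticalPhenomena-4575 --as helper`).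

For a chart `F : V → ℤ²` with exact-footprint quasi-steps `Skelφ.QStepsN G F N` («SkelPhiQStepsN») on a connected locally finite graph:
* §1 the FIBRE GRAPH `fib G F` (edges of `G` inside the fibres of `F`), the PORTS `port G F i` (vertices with a neighbour one unit up in coordinate `i`),
  and `joined_of_qStepsN`: every vertex is joined to both ports within length `N − 1` in the fibre graph (footprint induction on the `LinkN` walk);
* §2 **`exists_qsel`**: step data `nxt i v` / `wlk i v : G.Walk v (nxt i v)` in the two positive directions — far end one unit up, length `≤ N`, every
  vertex at the start value of `F` or the far end (a `LinkN`) — whose FIBRE CLOSURES (keep adding the same-fibre vertices of the chosen walks) are all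
  FINITE (the abstract selection lemma `QSel.exists_goodSel` of file I on the fibre graph);
* §3 **`finite_spawnClosure`**: for such step data the closure of a vertex (or a finite set) under "at a vertex whose chart value lies in a region `B`
  of bounded potential `c 0 + c 1`, add every vertex of both chosen walks" is FINITE — the quasi version of `finite_hull` of the scaled template
  «PlanarSkeletonFrmScaledRayHull» (there each step is one edge raising the potential; here interior vertices keep it and the fibre closure is finite).
[cite: AizenmanGrimmett1991, §2 (finite regions)] [cite: KozmaNitzan2024, §4 p. 19 (Step III)]
-/

noncomputable section

namespace Summit.CriticalPhenomena.PercolationContinuityZ3.Theorems.Transplant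

namespace Skelφ

/-! ## §1 Fibre graph and ports -/

open SimpleGraph Literature.Probability.LatticeModels
open Literature.Barriers.CriticalPhenomena (countable_of_connected_of_locallyFinite)
open scoped Classical

variable {V : Type} {G : SimpleGraph V} {F : V → Site 2} {N : ℕ}

variable (G F) in
/-- **The fibre graph** of a chart: the edges of `G` inside the fibres of `F`. [this work] -/
def fib : SimpleGraph V where
  Adj u v := G.Adj u v ∧ F u = F v
  symm := ⟨fun _ _ h => ⟨h.1.symm, h.2.symm⟩⟩
  loopless := ⟨fun _ h => G.irrefl h.1⟩

/-- The fibre graph is a subgraph. [folklore] -/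
theorem fib_le : fib G F ≤ G := fun _ _ h => h.1

/-- Walks of the fibre graph stay in one fibre. [folklore] -/
theorem F_eq_of_mem_support_fib {v u : V} (p : (fib G F).Walk v u) : ∀ x ∈ p.support, F x = F v := by
  induction p with
  | nil => intro x hx; rw [Walk.support_nil, List.mem_singleton] at hx; rw [hx]
  | cons h _ ih =>
    intro x hx
    rw [Walk.support_cons, List.mem_cons] at hx
    rcases hx with rfl | hx
    · rfl
    · rw [ih x hx, h.2]

/-- In particular the end of a fibre walk has the start's value. [folklore] -/
theorem F_end_fib {v u : V} (p : (fib G F).Walk v u) : F u = F v := F_eq_of_mem_support_fib p u p.end_mem_support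

/-- A fibre walk as a walk of `G`. [folklore] -/
def ofFib : ∀ {v u : V}, (fib G F).Walk v u → G.Walk v u
  | _, _, .nil => .nil
  | _, _, .cons h p => .cons h.1 (ofFib p)

/-- Same length. [folklore] -/
theorem length_ofFib : ∀ {v u : V} (p : (fib G F).Walk v u), (ofFib p).length = p.length
  | _, _, .nil => rfl
  | _, _, .cons _ p => by rw [ofFib, Walk.length_cons, Walk.length_cons, length_ofFib p]

/-- Same support. [folklore] -/
theorem support_ofFib : ∀ {v u : V} (p : (fib G F).Walk v u), (ofFib p).support = p.support
  | _, _, .nil => rfl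
  | _, _, .cons _ p => by rw [ofFib, Walk.support_cons, Walk.support_cons, support_ofFib p]

variable (G F) in
/-- **The ports** of direction `i`: vertices with a `G`-neighbour one unit up in coordinate `i`. [this work] -/
def port (i : Fin 2) : Set V := {u | ∃ u', G.Adj u u' ∧ F u' = F u + Pi.single i 1}

/-- Footprint induction: a `G`-walk at the start value of `F` except for its (differently valued) far end contains a FIBRE walk, one edge shorter,
to a vertex adjacent to the far end. [this work] -/
theorem exists_fibWalk_of_footprint {w' : V} :
    ∀ {v : V} (p : G.Walk v w'), (∀ u ∈ p.support, F u = F v ∨ u = w') → F v ≠ F w' →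
      ∃ (u : V) (q : (fib G F).Walk v u), q.length + 1 ≤ p.length ∧ G.Adj u w'
  | _, .nil, _, hne => (hne rfl).elim
  | v, .cons (v := x) h p', hfoot, hne => by
    by_cases hx : x = w'
    · subst hx
      exact ⟨v, Walk.nil, by rw [Walk.length_nil, Walk.length_cons]; omega, h⟩
    · have hFx : F x = F v :=
        (hfoot x (by rw [Walk.support_cons]; exact List.mem_cons_of_mem _ p'.start_mem_support)).resolve_right hx
      have hfoot' : ∀ u ∈ p'.support, F u = F x ∨ u = w' := fun u hu => by
        rw [hFx]; exact hfoot u (by rw [Walk.support_cons]; exact List.mem_cons_of_mem _ hu)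
      obtain ⟨u, q, hq, hadj⟩ := exists_fibWalk_of_footprint p' hfoot' (hFx ▸ hne)
      exact ⟨u, Walk.cons (v := x) ⟨h, hFx.symm⟩ q, by rw [Walk.length_cons, Walk.length_cons]; omega, hadj⟩

/-- A unit vector is nonzero (via `Pi.single_injective`; kept private — many tree files carry the same one-liner). [folklore] -/
private theorem single_one_ne_zero (i : Fin 2) : (Pi.single i 1 : Site 2) ≠ 0 :=
  fun h => one_ne_zero (Pi.single_injective i (h.trans (Pi.single_zero i).symm))

/-- The potential of a unit vector is one. [folklore] -/
theorem single_sum_two (i : Fin 2) : (Pi.single i (1 : ℤ) : Site 2) 0 + (Pi.single i (1 : ℤ) : Site 2) 1 = 1 := by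
  rcases Fin.exists_fin_two.mp ⟨i, rfl⟩ with rfl | rfl <;> simp

/-- **Quasi-steps make every vertex joined to both ports within length `N − 1` in the fibre graph.** [this work] -/
theorem joined_of_qStepsN (hq : QStepsN G F N) : QSel.Joined (fib G F) (port G F) (N - 1) := by
  intro i v
  obtain ⟨w', hF, p, hp, hfoot⟩ := hq v i 1
  rw [Units.val_one] at hF
  have hne : F v ≠ F w' := by
    rw [hF]; intro h
    exact single_one_ne_zero i (by simpa using h.symm)
  obtain ⟨u, q, hq', hadj⟩ := exists_fibWalk_of_footprint p hfoot hne
  exact ⟨u, ⟨w', hadj, by rw [F_end_fib q, hF]⟩, q, by omega⟩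

/-! ## §2 The quasi-step selection -/

/-- **THE QUASI-STEP SELECTION**: for a chart with exact-footprint quasi-steps of cost `N` on a connected locally finite graph there are step data in
the two positive directions — a far end `nxt i v` one unit up in coordinate `i` and a walk to it of length `≤ N` at the start value of `F` (a `LinkN`) —
such that the FIBRE CLOSURE of every vertex (keep adding the same-fibre vertices of the chosen walks) is FINITE. [this work] -/
theorem exists_qsel [G.LocallyFinite] (hc : G.Connected) (hq : QStepsN G F N) :
    ∃ (nxt : Fin 2 → V → V) (wlk : ∀ (i : Fin 2) (v : V), G.Walk v (nxt i v)),
      (∀ i v, F (nxt i v) = F v + Pi.single i 1) ∧ (∀ i v, (wlk i v).length ≤ N) ∧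
      (∀ i v, ∀ u ∈ (wlk i v).support, F u = F v ∨ u = nxt i v) ∧
      ∀ v, {x | Relation.ReflTransGen (fun a b => ∃ i, b ∈ (wlk i a).support ∧ F b = F a) v x}.Finite := by
  rcases isEmpty_or_nonempty V with hV | ⟨⟨v₀⟩⟩
  · exact ⟨fun _ v => v, fun _ v => Walk.nil, fun _ v => isEmptyElim v, fun _ v => isEmptyElim v,
      fun _ v => isEmptyElim v, fun v => isEmptyElim v⟩
  haveI : Countable V := countable_of_connected_of_locallyFinite G hc v₀
  obtain ⟨sel, hgood, hfin⟩ := QSel.exists_goodSel (joined_of_qStepsN hq)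
  have hport : ∀ i v, ∃ u', G.Adj (sel i v).1 u' ∧ F u' = F (sel i v).1 + Pi.single i 1 := fun i v => (hgood i v).1
  choose nxt hadj hFn using hport
  have hN : 1 ≤ N := by
    obtain ⟨w', hF, p, hp, -⟩ := hq v₀ 0 1
    rw [Units.val_one] at hF
    rcases p with _ | ⟨h, p'⟩
    · exact (single_one_ne_zero 0 (by simpa using hF.symm)).elim
    · rw [Walk.length_cons] at hp; omega
  refine ⟨nxt, fun i v => (ofFib (sel i v).2).concat (hadj i v), fun i v => ?_, fun i v => ?_, fun i v u hu => ?_,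
    fun v => (hfin v).subset fun x hx => ?_⟩
  · rw [hFn, F_end_fib (sel i v).2]
  · rw [Walk.length_concat, length_ofFib]
    have := (hgood i v).2; omega
  · rw [Walk.support_concat, List.mem_append, support_ofFib, List.mem_singleton] at hu
    rcases hu with hu | hu
    · exact Or.inl (F_eq_of_mem_support_fib _ u hu)
    · exact Or.inr hu
  · have hx' : Relation.ReflTransGen
        (fun a b => ∃ i, b ∈ ((ofFib (sel i a).2).concat (hadj i a)).support ∧ F b = F a) v x := hx
    show Relation.ReflTransGen (QSel.Rel sel) v x
    clear hx
    induction hx' with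
    | refl => exact Relation.ReflTransGen.refl
    | @tail b c _ hbc ih =>
      obtain ⟨i, hb, hFb⟩ := hbc
      rw [Walk.support_concat, List.mem_append, support_ofFib, List.mem_singleton] at hb
      rcases hb with hb | hb
      · exact ih.tail ⟨i, hb⟩
      · exfalso
        rw [hb, hFn, F_end_fib (sel i b).2] at hFb
        simp only [add_eq_left] at hFb
        exact single_one_ne_zero i hFb

/-! ## §3 Finite hulls -/

/-- **FINITE HULLS** (the quasi version of `finite_hull` of the scaled template): with step data as in `exists_qsel`, the closure of a vertex under
"at a vertex whose chart value lies in the spawning region `B`, add all vertices of both chosen walks" is FINITE whenever the potential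
`c 0 + c 1` is bounded above on `B` (far ends raise it by one; same-fibre vertices are finitely many). [this work] -/
theorem finite_spawnClosure {nxt : Fin 2 → V → V} {wlk : ∀ (i : Fin 2) (v : V), G.Walk v (nxt i v)}
    (hnxt : ∀ i v, F (nxt i v) = F v + Pi.single i 1) (hfoot : ∀ i v, ∀ u ∈ (wlk i v).support, F u = F v ∨ u = nxt i v)
    (hfin : ∀ v, {x | Relation.ReflTransGen (fun a b => ∃ i, b ∈ (wlk i a).support ∧ F b = F a) v x}.Finite)
    (B : Set (Site 2)) (K : ℤ) (hB : ∀ c ∈ B, c 0 + c 1 ≤ K) (v : V) :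
    {x | Relation.ReflTransGen (fun a b => F a ∈ B ∧ ∃ i, b ∈ (wlk i a).support) v x}.Finite := by
  -- notation
  let Fr : V → V → Prop := fun a b => ∃ i, b ∈ (wlk i a).support ∧ F b = F a
  let Sp : V → V → Prop := fun a b => F a ∈ B ∧ ∃ i, b ∈ (wlk i a).support
  have hFr : ∀ {a b}, Relation.ReflTransGen Fr a b → F b = F a := by
    intro a b h
    induction h with
    | refl => rfl
    | tail _ hbc ih => obtain ⟨-, -, h⟩ := hbc; rw [h, ih]
  -- decomposition of a spawn path: inside the fibre closure, or through a far end of a fibre-closure vertex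
  have hdec : ∀ {a x}, Relation.ReflTransGen Sp a x →
      Relation.ReflTransGen Fr a x ∨ ∃ a', Relation.ReflTransGen Fr a a' ∧ F a' ∈ B ∧ ∃ i, Relation.ReflTransGen Sp (nxt i a') x := by
    intro a x h
    refine Relation.ReflTransGen.head_induction_on h (Or.inl Relation.ReflTransGen.refl) ?_
    intro a' b hab hbx ih
    obtain ⟨haB, i, hb⟩ := hab
    rcases hfoot i a' b hb with hFb | hb'
    · have hab' : Fr a' b := ⟨i, hb, hFb⟩
      rcases ih with h | ⟨a'', ha'', hB'', j, hj⟩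
      · exact Or.inl (Relation.ReflTransGen.head hab' h)
      · exact Or.inr ⟨a'', Relation.ReflTransGen.head hab' ha'', hB'', j, hj⟩
    · subst hb'
      exact Or.inr ⟨a', Relation.ReflTransGen.refl, haB, i, hbx⟩
  -- induction on the potential gap
  suffices h : ∀ (n : ℕ) (v : V), K - (F v 0 + F v 1) < n → {x | Relation.ReflTransGen Sp v x}.Finite from
    h ((K - (F v 0 + F v 1)).toNat + 1) v (by have := Int.self_le_toNat (K - (F v 0 + F v 1)); push_cast; omega)
  intro n
  induction n with
  | zero =>
    intro v hv
    refine (Set.finite_singleton v).subset fun x hx => ?_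
    rcases Relation.ReflTransGen.cases_head hx with rfl | ⟨b, ⟨hvB, -⟩, -⟩
    · rfl
    · have := hB _ hvB; push_cast at hv; omega
  | succ n ih =>
    intro v hv
    have hfr := hfin v
    refine (hfr.union (hfr.biUnion fun a ha => Set.finite_iUnion fun i : Fin 2 => ih (nxt i a) ?_)).subset fun x hx => ?_
    · have hFa : F a = F v := hFr ha
      have hs : F (nxt i a) 0 + F (nxt i a) 1 = F v 0 + F v 1 + 1 := by
        rw [hnxt, hFa, Pi.add_apply, Pi.add_apply]; linarith [single_sum_two i]
      push_cast at hv ⊢; omega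
    · rcases hdec hx with h | ⟨a', ha', -, i, hi⟩
      · exact Or.inl h
      · exact Or.inr (Set.mem_biUnion ha' (Set.mem_iUnion.mpr ⟨i, hi⟩))

/-- Finite hulls of finite sets. [this work] -/
theorem finite_spawnClosure_of_finite {nxt : Fin 2 → V → V} {wlk : ∀ (i : Fin 2) (v : V), G.Walk v (nxt i v)}
    (hnxt : ∀ i v, F (nxt i v) = F v + Pi.single i 1) (hfoot : ∀ i v, ∀ u ∈ (wlk i v).support, F u = F v ∨ u = nxt i v)
    (hfin : ∀ v, {x | Relation.ReflTransGen (fun a b => ∃ i, b ∈ (wlk i a).support ∧ F b = F a) v x}.Finite)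
    (B : Set (Site 2)) (K : ℤ) (hB : ∀ c ∈ B, c 0 + c 1 ≤ K) {S₀ : Set V} (hS₀ : S₀.Finite) :
    {x | ∃ v ∈ S₀, Relation.ReflTransGen (fun a b => F a ∈ B ∧ ∃ i, b ∈ (wlk i a).support) v x}.Finite :=
  (hS₀.biUnion fun v _ => finite_spawnClosure hnxt hfoot hfin B K hB v).subset fun _ ⟨_, hv, hx⟩ => Set.mem_biUnion hv hx

end Skelφ

end Summit.CriticalPhenomena.PercolationContinuityZ3.Theorems.Transplant

end
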